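import Summits.SmoothPoincare4.SmoothPoincare4.Theses.ZeroSurgeryExotic
import Literature.Uncategorized.Crux
import Literature.Topology.FourManifolds.GaussDiagramsRegularPosition
import Literature.Topology.FourManifolds.SliceRibbonIsotopyProofs
import Literature.Topology.FourManifolds.KirbyMovesIsotopyProofs
import Literature.Topology.FourManifolds.KnotsIsotopyProofs
import HarnessLib

/-!
# Strategist sketch for crux `ZeroSurgeryExotic.ZseThesis` (stmt-SmoothPoincare4-0364)

Certificates for the STRATEGY-CENSUS / PLAN of the standing crux-strategist
(planner-cstrat-stmt-SmoothPoincare4-0364-h1-0, 2026-08-17). Everything is stated over existing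
declarations; no `sorry`.

* §1 NAMED-CELL CALCULUS. `CellA G` ("every knot reading the Gauss code `G` has a `0`-friend that is
  not smoothly slice") and `CellB G` ("some knot reading `G` is smoothly slice") compose to the crux
  (`zseThesis_of_cell`, `zseThesis_of_cells`), and conversely every witness of the crux is a live cell
  (`exists_cell_of_zseThesis`, mod the named fact `Knot.reidemeister` = GPV Thm 1.B, undischarged).
  So the crux is EXACTLY "some Gauss code is a live cell"; the printed knowledge (Dunfield–Gong 2025,
  Thm 5.14 / Table 11) pins three codes — 16n68278, 17nh0010647, 18nh00098198 — for which `CellA` is a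
  (computer-assisted) THEOREM in print (certified `0`-surgery homeomorphism + `s̃_c(K') ≠ 0`, DLS) and
  `CellB` is the open bet. NOTE: `CellA` is typed with the BARE `¬ IsSmoothlySlice`; the refined
  (LEO) tier enters only its eventual proof, never its statement — no refined-invariant vocabulary is
  needed to register the line, only the Gauss code (data want filed).
* §2 CHAIN COLLAPSE. A Piccirillo-type certificate (non-sliceness of `K'` read off an `s ≠ 0`
  trace- or surgery-friend `J` of `K'`) re-enters the friend class: `(K, J, Y)` is then a hit of the
  sibling crux 0366 (`crux_of_chain`). In the `s`-tier, 0364 and 0366 coincide.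
* §3 COSTUME CERTIFICATE. An abstract obstruction functional makes the "refined witness" shape
  literally equivalent to the crux (`abstractObstruction_iff`): a line must fix the tier concretely.
-/

noncomputable section

set_option linter.dupNamespace false

open scoped Manifold ContDiff
open Set Function
open Literature.Topology.FourManifolds Literature.Uncategorized
open Summit.SmoothPoincare4.SmoothPoincare4.Theses.ZeroSurgeryExotic

namespace Summit.SmoothPoincare4.SmoothPoincare4.Cruxes.ZseThesis.Strategist

/-- Local notation: `𝔼 n` is `EuclideanSpace ℝ (Fin n)`. -/
local notation "𝔼 " n:arg => EuclideanSpace ℝ (Fin n)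

/-! ## §1 Named-cell calculus -/

/-- **Cell A of a Gauss code `G`**: every knot reading `G` has a `0`-friend that is not smoothly
slice (bare non-sliceness: ANY obstruction may be used in a proof; for Dunfield–Gong's Table-11
codes it is the LEO invariant `s̃_c` of the partner). [cite: DunfieldGong2025, Thm. 5.14 and Table 11] -/
def CellA (G : GaussDiagram) : Prop :=
  ∀ K : Knot, K.HasGaussDiagram G →
    ∃ (K' : Knot) (Y : Type) (_ : TopologicalSpace Y) (_ : ChartedSpace (𝔼 3) Y),
      IsIntegralSurgery (𝓡 3) Y K 0 ∧ IsIntegralSurgery (𝓡 3) Y K' 0 ∧ ¬ K'.IsSmoothlySlice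

/-- **Cell B of a Gauss code `G`**: some knot reading `G` is smoothly slice (the bet; for the
Table-11 codes this is the hypothesis of Dunfield–Gong's Thm 5.14). [cite: DunfieldGong2025, Thm. 5.14] -/
def CellB (G : GaussDiagram) : Prop :=
  ∃ K : Knot, K.HasGaussDiagram G ∧ K.IsSmoothlySlice

/-- **A live cell proves the crux** (the composition of the planned line `table-eleven-cell`). [folklore] -/
theorem zseThesis_of_cell (G : GaussDiagram) (hA : CellA G) (hB : CellB G) : ZseThesis := by
  obtain ⟨K, hG, hK⟩ := hB
  obtain ⟨K', Y, _, _, h1, h2, h3⟩ := hA K hG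
  exact ⟨K, K', Y, _, _, h1, h2, hK, h3⟩

/-- **Finitely many cells, one of them slice** (the three Table-11 rows: `CellA` for each row is a printed
theorem, the bet is a disjunction). [cite: DunfieldGong2025, Thm. 5.14] -/
theorem zseThesis_of_cells {ι : Type*} (G : ι → GaussDiagram) (hA : ∀ i, CellA (G i))
    (hB : ∃ i, CellB (G i)) : ZseThesis := by
  obtain ⟨i, hi⟩ := hB
  exact zseThesis_of_cell (G i) (hA i) hi

/-- **Converse: every witness of the crux is a live cell** — modulo Reidemeister's theorem in Gauss-code
form (`Knot.reidemeister`, GPV Thm 1.B: a realised signed Gauss code determines the knot type; named fact,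
undischarged) and the PROVED facts: generic projections exist (`exists_hasGaussDiagram_of_isIsotopic_holds`),
sliceness and `0`-surgery are isotopy invariants (`IsSmoothlySlice.of_isIsotopic_holds`,
`IsIntegralSurgery.of_isIsotopic_holds`). [cite: GPV2000, Thm. 1.B] -/
theorem exists_cell_of_zseThesis (hR : Knot.reidemeister) (h : ZseThesis) :
    ∃ G : GaussDiagram, CellA G ∧ CellB G := by
  obtain ⟨K, K', Y, _, _, h1, h2, hK, hK'⟩ := h
  obtain ⟨K₁, G, hiso, hG⟩ := Knot.exists_hasGaussDiagram_of_isIsotopic_holds K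
  refine ⟨G, ?_, K₁, hG, Knot.IsSmoothlySlice.of_isIsotopic_holds hiso hK⟩
  intro K₂ hG₂
  have h12 : K₁.IsIsotopic K₂ := Knot.HasGaussDiagram.isIsotopic hR hG hG₂
  have hK2 : K.IsIsotopic K₂ := SphereEmbedding.IsIsotopic.trans_holds hiso h12
  exact ⟨K', Y, _, _, IsIntegralSurgery.of_isIsotopic_holds h1 hK2, h2, hK'⟩

/-- **The crux is exactly "some Gauss code is a live cell"** (mod `Knot.reidemeister`). [cite: GPV2000, Thm. 1.B] -/
theorem zseThesis_iff_exists_cell (hR : Knot.reidemeister) :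
    ZseThesis ↔ ∃ G : GaussDiagram, CellA G ∧ CellB G :=
  ⟨exists_cell_of_zseThesis hR, fun ⟨G, hA, hB⟩ ↦ zseThesis_of_cell G hA hB⟩

/-- `CellB` is monotone along "reads the same code": trivial bookkeeping used by the line card — a ribbon
certificate for ANY knot reading `G` settles the bet. [folklore] -/
theorem cellB_of_isRibbon {G : GaussDiagram} {K : Knot} (hG : K.HasGaussDiagram G) (hK : K.IsRibbon) :
    CellB G :=
  ⟨K, hG, hK.isSmoothlySlice⟩

/-! ## §2 Chain collapse: Piccirillo-type certificates re-enter the friend class -/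

/-- **Chain collapse.** If `(K, K', Y)` is a `0`-pair with `K` smoothly slice and the non-sliceness of `K'`
is certified à la Piccirillo — through a further knot `J` presenting the same `Y` by `0`-surgery (a
`0`-trace friend of `K'` is in particular such a `J`) with `s(J) ≠ 0` — then `(K, J, Y)` is already a hit
of the sibling crux 0366 (`Literature.Uncategorized.Crux`). So `s = 0` partners certified this way (the
Conway-knot pattern) give 0364 nothing beyond 0366. [cite: ManolescuPiccirillo2023, §1 p. 1 and Remark 1.5] -/
theorem crux_of_chain {K K' J : Knot} {Y : Type} [TopologicalSpace Y] [ChartedSpace (𝔼 3) Y] {s : ℤ}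
    (h1 : IsIntegralSurgery (𝓡 3) Y K 0) (_h2 : IsIntegralSurgery (𝓡 3) Y K' 0)
    (h3 : IsIntegralSurgery (𝓡 3) Y J 0) (hK : K.IsSmoothlySlice) (hJ : J.HasRasmussenInvariant s)
    (hs : s ≠ 0) : Crux :=
  ⟨K, J, Y, _, _, s, h1, h3, hK, hJ, hs⟩

/-! ## §3 Costume certificate for abstract obstructions -/

/-- **An abstract obstruction functional is a costume of the crux**: quantifying the witness tier as
"some predicate vanishing on slice knots" makes the refined-witness shape literally equivalent to
`ZseThesis` (take `Ω K := ¬ K.IsSmoothlySlice`). Hence a line must fix the tier CONCRETELY (a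
diagram-computable invariant) or pin NAMED data (§1). [folklore] -/
theorem abstractObstruction_iff :
    (∃ Ω : Knot → Prop, (∀ K : Knot, K.IsSmoothlySlice → ¬ Ω K) ∧
      ∃ (K K' : Knot) (Y : Type) (_ : TopologicalSpace Y) (_ : ChartedSpace (𝔼 3) Y),
        IsIntegralSurgery (𝓡 3) Y K 0 ∧ IsIntegralSurgery (𝓡 3) Y K' 0 ∧ K.IsSmoothlySlice ∧ Ω K') ↔
    ZseThesis := by
  constructor
  · rintro ⟨Ω, hΩ, K, K', Y, _, _, h1, h2, hK, hK'⟩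
    exact ⟨K, K', Y, _, _, h1, h2, hK, fun hs ↦ hΩ K' hs hK'⟩
  · rintro ⟨K, K', Y, _, _, h1, h2, hK, hK'⟩
    exact ⟨fun K ↦ ¬ K.IsSmoothlySlice, fun K hs h ↦ h hs, K, K', Y, _, _, h1, h2, hK, hK'⟩

end Summit.SmoothPoincare4.SmoothPoincare4.Cruxes.ZseThesis.Strategist

end
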